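import Summits.SmoothPoincare4.SmoothPoincare4.Theses.ZeroSurgeryExotic
import Literature.Topology.FourManifolds.LeeRasmussen
import Literature.Topology.FourManifolds.Rasmussen
import Literature.Topology.FourManifolds.RasmussenProofs
import Literature.Topology.FourManifolds.RasmussenConcordanceProofs
import Literature.Topology.FourManifolds.DehnSurgeryProofs
import Literature.Topology.FourManifolds.ZeroSurgeryHomotopyBallSliceProofs
import Literature.Topology.FourManifolds.ZeroSurgeryHomotopyBallSliceHolds
import Literature.Topology.FourManifolds.HomotopyBallSliceProofs
import Literature.Topology.FourManifolds.KnotsProofs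
import Literature.Topology.FourManifolds.LeeRasmussenParityProofs
import Literature.Barriers.SmoothPoincare4.GluckTwistsDissolve
import Literature.Topology.FourManifolds.ConnectedSum
import Literature.Topology.FourManifolds.ComplexProjectiveSpace
import Literature.Topology.FourManifolds.ConnectedSumSphereIdentity
import Literature.Uncategorized.Crux
import Literature.Topology.FourManifolds.KnotsIsotopyProofs
import Literature.Topology.FourManifolds.SliceRibbonIsotopyProofs
import Summits.SmoothPoincare4.SmoothPoincare4.Theorems.ZseSVanishesOnPairs.Negative.MirrorClosure

/-!
# Disproof work file — crux `zse_crux_rasmussen` (stmt-SmoothPoincare4-0366, route ZeroSurgeryExotic, crux #2)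

Crux (ledger signature, verbatim; the decl `ZseCruxRasmussen` is NOT materialised in the route file
`Theses/ZeroSurgeryExotic.lean` — it sits there as a TODO comment because the route file does not
`import Literature.Topology.FourManifolds.LeeRasmussen`; everything below is therefore about the local
transcription `Crux` — now `Literature.Uncategorized.Crux`, see §0 — which elaborates verbatim with that one import):

  ∃ K K' Y s, Y = S³₀(K) (`IsIntegralSurgery (𝓡 3) Y K 0`) ∧ Y = S³₀(K') ∧ K smoothly slice ∧
    `K'.HasRasmussenInvariant s` ∧ s ≠ 0.

## Findings (cycle 1, 2026-08-16) — the crux RESISTS; here is why, as checked Lean: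

* §1 NO JUNK ESCAPE, EVERY CONJUNCT LOAD-BEARING. Each conjunct is inhabited by tree THEOREMS
  (0-surgery exists on every knot: `exists_isIntegralSurgery_holds`; unknot slice; s(unknot) = 0,
  s(T(2,3)) = 2 unconditionally: `hasRasmussenInvariant_torusKnot_holds`), and the crux with ANY ONE
  conjunct deleted is PROVED below (`cruxWithout…_holds`). So the statement is neither junk-false
  (the `s ≠ 0` conjunct is genuinely satisfiable, s being the honest Lee-complex invariant) nor
  junk-true; the whole difficulty is the conjunction "common 0-surgery + K slice + s(K') ≠ 0".
* §2 DEAD STRENGTHENINGS (mod Rasmussen's Thm 1 `eq_zero_of_isSmoothlySlice`, a named fact of the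
  tree, not yet discharged): K = K' is impossible; K' concordant to K is impossible
  (`Knot.IsConcordant.isSmoothlySlice`); K' slice is impossible. Hence any witness pair is
  NON-CONCORDANT with homeomorphic 0-surgeries (Yasui-2015-type pairs), and in particular the
  0-surgery homeomorphism must NOT extend to a 0-trace diffeomorphism (trace embedding lemma; not in
  tree) — this is the printed content of Nakamura 2023 Thm 3.13 / Dunfield–Gong 2025 Thm 5.9 for the
  (super-)special RBG families, which are therefore dead supply.
* §3 EXACT STRENGTH OF A DISPROOF. `¬ Crux ↔ SVanishesOnPairs` (= item 0368 verbatim) and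
  `MMSW2023Question911Knot → ¬ Crux` (MMSW 2023 Question 9.11, registered OPEN in
  `Literature/Barriers/SmoothPoincare4/GluckTwistsDissolve.lean`), via the PROVED Manolescu–Piccirillo
  Lemma 3.3 (`Knot.ManolescuPiccirillo2023_lemma33_sphere_holds`); and
  `SmoothPoincare4 → eq_zero_of_isSmoothlySlice → MMSW2023Question911Knot` via the PROVED FGMW lemma.
  Conversely `Crux → FGMWRasmussenStrategy` (registered OPEN conjecture) and
  `Crux → ZseThesis` (mod Rasmussen Thm 1). So a disproof of the crux is EXACTLY a proof of the
  0-surgery-pair case of MMSW Q9.11 — open in print (KM 2013 Cor 1.1 withdrawn; MMSW Cor 1.13 covers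
  Gluck twists only; Manolescu's 2026 survey arXiv:2601.05425 p.24: no pair found, no vanishing
  theorem beyond the RBG families). No finite computation can refute an existential of this shape.
* §4 BARRIER SUB-FAMILY: mod MMSW Cor 1.13 (`rasmussen_eq_zero_of_isSliceDiscIn_gluckTwist`, named
  fact) no homotopy sphere carrying the K'-disc of a witness is a Gluck twist
  (`crux_witness_avoids_gluckTwist`).
* §5 NEAR-MISS / KILL SWITCH (sorried, OPEN): `SVanishesOnPairs` itself.
* §6 NORMALISATION: `hasRasmussenInvariant_even`, `crux_iff_two_le_abs` (the witness clause may be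
  read `2 ≤ |s|`).
* SUPPLY SIDE (print, docstring-level — the tree has no RBG links): Dunfield–Gong 2025
  (arXiv:2512.21825) p.44 Thm 5.9 [Nakamura 2023 Thm 3.13 + Ren 2024 Cor 1.5]: "Suppose L is a
  super-special RBG link. Suppose s_F(K_G) ≠ 0 ... Then both K_B and K_G are not smoothly slice" —
  so every 0-surgery pair presented by a SUPER-SPECIAL RBG link (R∪B, R∪G Hopf, b = g = 0, r ∈ ℤ)
  with the slice knot Blue is dead for this crux; their Table 11 (p.48) live pairs all carry
  super-special RBG links and the non-slice partner is detected only by the LEO refinement s̃_c,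
  i.e. plain s(K') = 0 there: even if 16n68278 / 17nh_0010647 / 18nh_00098198 turn out slice
  (⇒ thesis 0364 and an exotic S⁴), they would NOT witness this s_ℚ-crux. Manolescu's survey
  arXiv:2601.05425 p.24 (Jan 2026): "As of now, no pairs (K, K′) with the above properties have been
  found." Literature sweep 2026-08-16 (local citation graph since 2025 over FGMW/MMSW/KM/Rasmussen/
  MP/Nakamura/DG/Ren–Willis): no vanishing theorem for s in homotopy balls (Nahm arXiv:2602.20138,
  Lidman–Piccirillo arXiv:2505.14387 are about exotic traces / slicing in rational homology spheres).

Provers: the positive side needs a CERTIFIED 0-surgery homeomorphism outside the Nakamura/DG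
families plus a certified Kh computation; nothing in this file obstructs that, but §2–§4 say where
not to look (concordant partners, trace-diffeomorphic pairs, Gluck-twist-born spheres).

## Findings (cycle 2, 2026-08-16, gen-2 seat) — still no kill; two new checked reductions:

* §7 THE PRICE OF A WITNESS IS AN EXOTIC `ℂℙ²`-SUM, NOT ONLY AN EXOTIC `S⁴` (new kill hypothesis
  strictly below SPC4 on paper). MMSW 2023 §9.3 (sentence after Question 9.11, materialised
  arXiv:1910.08195 p. 30: "the key facts we used ... were that `X # ℂℙ² ≅ ℂℙ²` and `X # ℂℙ²bar ≅ ℂℙ²bar`.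
  The same result would hold for any homotopy 4-sphere `X` satisfying `X # (#ʳℂℙ²) = #ʳℂℙ²` and
  `X # (#ʳℂℙ²bar) = #ʳℂℙ²bar` for some `r`"; proof = Cor. 6.15's via Cor. 6.13, p. 19) is rendered as
  the named fact `mmsw2023_sZero_of_dissolvesInCP2` (case `r = 1`, knots; over the tree's
  orientation-free `IsConnectedSum`, exactly as the catalogue renders Gluck-twist dissolution; LANDED in the
  catalogue file `Literature/Barriers/SmoothPoincare4/GluckTwistsDissolve.lean` by p76409, reviewer
  page-checked). THEN:
  `exoticCP2Sum_of_crux`: a crux witness yields a closed smooth homotopy 4-sphere `X` (the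
  Manolescu–Piccirillo sphere carrying the `K'`-disc) and a closed smooth CONNECTED SUM `P` of `X` with
  `ℂℙ²` admitting NO diffeomorphism to `ℂℙ²` — by Freedman `P` is homeomorphic to `ℂℙ²`, so the
  `s`-witness 0-surgery route must produce an EXOTIC `ℂℙ²` (up to orientation; with the sign of `s(K')`
  fixed, `Σ # rℂℙ²bar` resp. `Σ # rℂℙ²` stays exotic for EVERY `r ≥ 1`), whereas not one exotic
  closed definite simply connected 4-manifold is known (Manolescu's survey arXiv:2601.05425 p. 7: "All
  known exotic examples of simply-connected four-manifolds have the property that this form is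
  indefinite"; Question 3.2 there: "Does there exist an exotic smooth structure on `#n ℂℙ²` for some
  `n ≥ 0`?", presented p. 25 as a goal LESS ambitious than SPC4 — the theorem says this crux is at least
  as hard as its case `n = 1`). Kill form: `not_crux_of_cp2Rigid` —
  `CP2RigidOnHomotopySphereSums` (every closed smooth `Σ # ℂℙ²`, `Σ ≃ₕ S⁴`, is `≅ ℂℙ²`) + MMSW ⇒ `¬ Crux`;
  and `cp2Rigid_of_spc4 : SmoothPoincare4 → CP2RigidOnHomotopySphereSums` is PROVED here from tree
  theorems (`X # S⁴ ≅ X`: `nonempty_diffeomorph_of_isConnectedSum_sphere'`,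
  `IsConnectedSum.of_diffeomorph_left`), so the new kill hypothesis sits between SPC4 and `¬ Crux` and is
  also implied by "smooth structures on `ℂℙ²` are unique" — a DIFFERENT open problem the crux must settle
  negatively. Sanity (catalogue): the Gluck dissolution fact makes every Gluck twist `DissolvesInCP2`
  (`dissolvesInCP2_of_isGluckTwist`), so the new fact contains the vendored Cor. 1.13 on closed
  homotopy-sphere Gluck twists (`sZero_of_isSliceDiscIn_gluckTwist_of_mmsw2023`).
* §8 TOPOLOGICAL WITNESSES ARE DEAD (mod Freedman, named hypothesis `isTopologicallySlice_of_isHomotopyBallSlice`,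
  the same Prop as in `Ideator1Sketch.lean`): the partner `K'` of ANY 0-surgery pair with `K` smoothly
  slice is TOPOLOGICALLY slice (`isTopologicallySlice_partner`), so the variant of the crux whose witness
  clause is "`K'` not topologically slice" is FALSE (`cruxTopWitness_false_of_freedman`): signatures,
  Levine–Tristram, Arf, Fox–Milnor, Casson–Gordon can never certify a partner; only smooth-but-not-
  topological obstructions (s, its refinements, gauge/Floer-theoretic τ, ε, ν⁺, s♯, θ …) are candidates,
  and of those all but the Khovanov family are KNOWN to vanish on homotopy-ball-slice knots in print
  (they factor through (rational) homology concordance) — informal here: no knot Floer / instanton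
  objects in the tree.
* Bookkeeping (all LANDED, import them rather than this work file): §1–§4 = `Theorems/ZseCruxRasmussen/Negative/Shape.lean`
  (p76009); §6 = `…/Negative/Parity.lean` (p74212); §7 catalogue half = `Literature/Barriers/SmoothPoincare4/GluckTwistsDissolve.lean`
  section "Beyond Gluck twists" (p76409: `DissolvesInCP2`, named fact `mmsw2023_sZero_of_dissolvesInCP2`,
  `exoticCP2Sum_of_fgmwRasmussenStrategy`, `not_fgmwRasmussenStrategy_of_cp2Rigid`, …; the gate refuses new
  `@[conjecture]` statements in Literature, so `ℂℙ²`-rigidity travels there as a spelled-out hypothesis — a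
  planner wanting it as a kill switch files it Summits-side) + its proofs sibling
  `…/GluckTwistsDissolveBeyondGluckProofs.lean` (p77807: `S⁴` and every Gluck twist dissolve unconditionally;
  the §9.3 fact CONTAINS Rasmussen's Theorem 1 and MMSW Cor. 1.13 in full; fact ↔ one-sided bound `s ≤ 0`);
  §7 crux half = `…/Negative/CP2Cost.lean` (p77763: `exoticCP2Sum_of_crux`, `not_crux_of_cp2Rigid`,
  `dissolvesInCP2_of_spc4`, `not_crux_of_spc4_of_mmsw2023`); §8 = `…/Negative/TopologicalProfile.lean` (p77712).
  The sibling crux 0368's disprover landed `Theorems/ZseSVanishesOnPairs/Negative/{LoadBearing,Position,Strengthenings}.lean`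
  (SPC4 ⇒ 0368; Conway–Piccirillo pair kills the topological / `s(K) = 0` / framing-`m` variants of 0368 —
  read these as: any PROOF of the crux's negation must use the smooth disc of `K` and the framing `0`).
* ONE FACT RUNS EVERYTHING (note at the end of §7): since the §9.3 fact contains Rasmussen's Theorem 1
  and Cor. 1.13 (catalogue proofs sibling, p77807), every "mod Rasmussen" lemma of §2–§4 and the glue
  `Crux ⇒ ZseThesis` run mod `mmsw2023_sZero_of_dissolvesInCP2` alone; the tree's two undischarged
  `s`-inputs on this line (Rasmussen Thm 1, Cor. 1.13) and the new one collapse to the single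
  adjunction-inequality layer MMSW Cor. 6.13 (cobordism maps on Lee homology — absent from the tree's
  knots-only Lee complex).

## Findings (cycle 3, 2026-08-16, gen-3 seat) — still no kill; the technique class that cannot witness, and the death of the printed candidate:

* §9 HOMOTOPY-BALL-BLIND INVARIANTS (the abstract form of §8, as theorems over an arbitrary knot-invariant
  predicate `ι : Knot → ℤ → Prop`): call `ι` BLIND if it vanishes on every knot slice in a homotopy 4-ball
  (`IsHomotopyBallBlind ι`). PROVED: (i) a blind `ι` vanishes on the partner `K'` of EVERY 0-surgery pair with
  `K` slice (`blind_eq_zero_on_partner`, MP Lemma 3.3), so (ii) the crux with its witness clause read through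
  any blind invariant is FALSE (`cruxWithBlindWitness_false`), (iii) MMSW Question 9.11 IS the statement
  "`s` is blind" (`isHomotopyBallBlind_rasmussen_iff`, definitional) and the crux is EXACTLY "`s` is not blind on
  0-surgery-born balls"; (iv) THE FRIEND LEMMA `not_slice_of_pair_of_concordant_of_blind`: a 0-friend `K` of a
  knot `K'` concordant to a knot `K₀` carrying a NON-ZERO blind, concordance-invariant, everywhere-defined
  invariant is NOT smoothly slice; (v) `partner_not_concordant_of_blind`: the partner of a witness is concordant
  to no knot with a non-zero blind invariant. In print the blind class contains (cites in §9): Ozsváth–Szabó's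
  `τ` (OS 2003 Thm 1.1 with `b₂⁺ = b₁ = 0`; FGMW 2010 §1 p. 4: "if `K` is slice in any homotopy 4-ball, then
  `τ(K) = 0`"), `ε, ν⁺, Υ` and every knot-Floer concordance invariant (they factor through ℤ-homology
  concordance), the `s♯`-bound (KM 2013 Cor 1.1), all branched-cover / `d`-invariant obstructions to bounding a
  `ℤ/2`-homology ball (e.g. Dai–Kang–Mallick–Park–Stoffregen 2024: the `(2,1)`-cable of `4₁` "is not slice in
  any `ℤ/2ℤ`-homology ball"), and (Freedman, §8) every topological concordance invariant. CONSEQUENCES FOR THE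
  SEARCH (the τ-FILTER): a partner `K'` has `s(K') ≠ 0 = τ(K') = ε = ν⁺ = σ = …` — it lives in the
  Hedden–Ording regime `s ≠ 2τ`; positive, quasipositive (τ = g₄), alternating and quasi-alternating
  (`s = 2τ = -σ`), squeezed knots, L-space knots, and anything CONCORDANT to a knot with `τ ≠ 0` are dead as
  partners, whatever their 0-surgery.
* §9 KILLS THE ONLY PRINTED LIVE CANDIDATE WITH PLAIN `s ≠ 0`. Kegel–Spreer, "The search for exotic knot
  traces" (arXiv:2603.22438, March 2026), §6.2(1) p. 17: the 262-crossing knot `W₊''` (Fig. 11) shares its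
  0-surgery with `W₊'`, which is concordant (one ribbon band) to `W₊ = Wh⁺(T₂,₃)` (`s = 2`); "We do not know if
  `W₊''` is smoothly slice." It is NOT: `τ(W₊) = 1` (Hedden, Geom. Topol. 11 (2007), Thm. 1.4: `τ(D₊(K,t)) = 1`
  for `t < 2τ(K)`), `τ` is a blind concordance invariant, so by (iv) `W₊''` is not slice (were it slice, `W₊'`
  would be slice in a homotopy ball by MP 3.3, forcing `τ(W₊') = 0 ≠ 1 = τ(W₊)`). Likewise §6.2(3): the
  114-crossing `C''` (friend of `C'` ~ `C = (2,1)`-cable of `4₁`) is not slice, DKMPS's obstruction being blind.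
  The other Kegel–Spreer pools (§6.2(2) `W₋`, §6.4 the 3643 concordance friends of the Conway knot and of
  DG's `K16n68278, 17nh0010647, 18nh00098198`) have partners with `s = 0` (LEO-only / all invariants vanish):
  a slice member there would prove the THESIS 0364 and an exotic `S⁴`, but not this crux. So, as of 2026-08:
  MP's five (Nakamura 1.1), special / super-special RBG (Nakamura 3.13, DG 5.9), DG Table 11 (`s = 0`),
  Kegel–Spreer 2026 (τ-filter / `s = 0`) — EVERY printed candidate for the plain-`s` crux is dead or invisible,
  and no vanishing theorem beyond Gluck twists / dissolving spheres exists either. Genuinely open both ways.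
* §10 ONE FACT RUNS EVERYTHING (written and kept in the seat's folder as `OneFact.lean` / the full `Disproof.lean`;
  NOT in this published version because the farm does not yet serve the freshly landed
  `GluckTwistsDissolveBeyondGluckProofs` / `Negative/TopologicalProfile` modules — spliced in at the next publish):
  the primed one-liners `zseThesis_of_crux'`, `not_spc4_of_crux'`, `not_crux_of_assembly2'`,
  `crux_witness_avoids_gluckTwist'`, `witness_profile'` run modulo the SINGLE named fact
  `mmsw2023_sZero_of_dissolvesInCP2` (MMSW §9.3) (+ Freedman for the topological clause); and
  `not_crux_of_nonpos_of_cp2Rigid`: the ONE-SIDED bound "`s ≤ 0` for knots slice in dissolving homotopy spheres"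
  (= MMSW Eq. (6.1)/Cor. 6.13, exactly what is left of §9.3 in the tree) plus `ℂℙ²`-rigidity on homotopy-sphere
  sums already kills the crux.
* §11 SIGN NORMALISATION (unconditional, over the sibling disprover's mirror closure `pair_mirror`):
  `crux_iff_pos` / `crux_iff_two_le` — the crux is equivalent to its form with witness clause `2 ≤ s(K')`
  (mirror a negative witness: `(K̄, K̄', Y, -s)` is again a witness, `IsIntegralSurgery` being orientation-blind);
  a search may fix the sign, a disproof may assume `s(K') ≥ 2`. Also `eq_zero_of_amphichiral` /
  `crux_partner_chiral`: amphichiral partners are dead (mod single-valuedness of `s`).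
* §12 DEGENERATE SEED: `crux_false_of_unknotSeed` — no witness has `K` = unknot, modulo Property R in friend
  form (Gabai 1987 Cor. 8.3: a 0-friend of the unknot is unknotted; the tree's named fact
  `isUnknot_of_isIntegralSurgery_zero` lives on `S² × S¹` with its product model, and surgery transport across
  models on different vector spaces is not in the tree, whence the restatement) and Rasmussen's Theorem 1.
* TARGETS (lead's line `monodromy-kernel-engine`, stub `stub_kernelWitness` = the crux on the sector {`K` ribbon
  fibred, `K'` fibred over the same closed monodromy `φ̂`}; no stuck stubs handed over yet). Negative knowledge for
  that sector, informal (no knot Floer theory / traces in the tree): (a) genus ≥ 2 (the genus-1 fibred knots are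
  `3₁`, `4₁`, neither slice); (b) by the τ-filter the fibred partner `K'` has `τ(K') = 0`, so it is neither
  strongly quasipositive nor the mirror of one (Hedden 2010: fibred & `τ = g` ⟺ SQP), in particular not a
  positive or negative braid closure, and `s(K') ≠ 2τ(K')`; (c) when `K` is ribbon the MP disc of `K'` is
  HOMOTOPY-RIBBON (its exterior is the ribbon-disc exterior `V` of `K`, and `π₁(S³ ∖ K') ↠ π₁(Y) ↠ π₁(V)`), so
  Casson–Gordon 1983 Thm. 5.1 governs the sector: the MKE homotopy balls have disc exteriors of the homotopy
  type of a handlebody bundle `H_g ×_Φ S¹`, `Φ` an extension of the common closed monodromy — literally the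
  Casson–Gordon ball `(H_g ×_Φ S¹) ∪ h²` when `K`'s ribbon disc is fibred (Larson–Meier) — i.e. the line bets on
  a NON-STANDARD Casson–Gordon ball detected by `s`, while the geometrically simply connected spheres settled in
  print are all standard (Gompf 1991 / Akbulut 2010: Cappell–Shaneson; Meier–Zupan, J. Differential Geom. 2022,
  Thm. 1.1: no 1-handles and two 2-handles one of which is attached along `T_{p,q} # T_{-p,q}` — note that for a
  FUSION-NUMBER-ONE ribbon `K` the MP sphere is exactly such an `X_L`, `L = K' ∪ R` a 2R-link, so the
  Generalized Property R conjecture for 2R-links would kill the whole fusion-one sector); (d) DUAL-KNOT SIEVE: in a witness NO diffeomorphism of `Y`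
  may carry the dual knot (= meridian of `K'` in `Y`) to the dual knot of `K` — otherwise the 0-traces are
  diffeomorphic (the trace is `Y × I ∪` a 2-handle on the dual knot `∪ B⁴`, the handle's slope being pinned to
  the meridian by Gordon–Luecke) and `K'` is slice together with `K` (trace embedding lemma, MP 2023 Lemma 3.5),
  so `s(K') = 0`; in the fibred sector the dual knots are the sections of `T_φ̂ → S¹` through the via points, so
  the engine must output twins whose sections are INEQUIVALENT under `Diff(T_φ̂)`; vertical-isotopy classes of
  sections are the `φ̂_*`-twisted-conjugacy (Reidemeister) classes of `π₁(F̂)` — the first, GAP-computable,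
  sieve (same class ⇒ dead), to be followed by the action of the symmetries of `T_φ̂`.
* Bookkeeping: §9 ⇒ proposal `Theorems/ZseCruxRasmussen/Negative/BlindInvariants.lean`; §10–§12 ⇒
  `…/Negative/Normalisation.lean` (ids in NOTES/ledger). The sibling crux 0368's disprover meanwhile landed
  `Theorems/ZseSVanishesOnPairs/Negative/{MirrorClosure, MirrorConsequences, ConcordanceFriends, GluckLeverPosition,
  Targets, HeightZero}.lean` — read for THIS crux: `s` is not a 0-surgery invariant (T(2,3) vs its mirror share
  `S³₀`), counterexamples come in mirror pairs, the crux ⟺ "a slice concordance-friend of a knot with `s ≠ 0`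
  exists" (Kegel–Spreer's Algorithm 6 — whose one plain-`s` instance §9 kills), and a witness's MP sphere is not
  of Schoenflies type `B ∪_∂ B⁴`, `B ⊂ S⁴` (HeightZero, mod Rasmussen Thm 1).
-/

noncomputable section

set_option linter.dupNamespace false

open scoped Manifold ContDiff
open Literature.Topology.FourManifolds Literature.Barriers.SmoothPoincare4 Literature.Uncategorized

namespace Summit.SmoothPoincare4.SmoothPoincare4.Cruxes.ZseCruxRasmussen.Disproof

/-- Local notation: `𝔼 n` is `EuclideanSpace ℝ (Fin n)`. -/
local notation "𝔼 " n:arg => EuclideanSpace ℝ (Fin n)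

/-! ## §0 The crux and its kill test

`Crux` (= item 0366, ledger signature verbatim) and `SVanishesOnPairs` (= item 0368 verbatim) now live in
`Literature/Uncategorized/Crux.lean` as `Literature.Uncategorized.Crux` / `….SVanishesOnPairs`: the gate
RELOCATED them there (p72944, 2026-08-16) from the first version of the landed helper file
`Theorems/ZseCruxRasmussen/Negative/Shape.lean` because their docstrings carried `[cite]` tags; a repair
proposal (p73481) re-tags them `@[conjecture]` / [status: open] (they are OPEN route items, not literature
facts) and asks the librarian to rename/re-home them. Import that module to talk about the crux by name. -/

/-- `¬ Crux` is literally the kill test 0368. [folklore] -/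
theorem not_crux_iff_sVanishesOnPairs : ¬ Crux ↔ SVanishesOnPairs := by
  constructor
  · intro h K K' Y _ _ s hK hK' hsl hs
    by_contra hs0
    exact h ⟨K, K', Y, _, _, s, hK, hK', hsl, hs, hs0⟩
  · rintro h ⟨K, K', Y, _, _, s, hK, hK', hsl, hs, hs0⟩
    exact hs0 (h K K' Y s hK hK' hsl hs)

/-! ## §1 No junk escape: every conjunct is inhabited, every one-conjunct deletion is provable -/

/-- The `s`-witness conjunct is genuinely satisfiable: the right-handed trefoil `T(2,3)` has
Rasmussen invariant `2 ≠ 0`, an UNCONDITIONAL theorem of the tree (Lee complex of the standard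
positive braid diagram). So the crux is not junk-false through a degenerate `HasRasmussenInvariant`.
[cite: Rasmussen2010, Thm. 4] -/
theorem sWitness_inhabited :
    ∃ (K : Knot) (s : ℤ), K.HasRasmussenInvariant s ∧ s ≠ 0 :=
  ⟨torusKnot 2 3 le_rfl (by norm_num) (by norm_num),
    ((2 : ℤ) - 1) * ((3 : ℤ) - 1),
    hasRasmussenInvariant_torusKnot_holds 2 3 le_rfl (by norm_num) (by norm_num), by norm_num⟩

/-- The crux with `K.IsSmoothlySlice` deleted. -/
def CruxWithoutSlice : Prop :=
  ∃ (K K' : Knot) (Y : Type) (_ : TopologicalSpace Y) (_ : ChartedSpace (𝔼 3) Y) (s : ℤ),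
    IsIntegralSurgery (𝓡 3) Y K 0 ∧ IsIntegralSurgery (𝓡 3) Y K' 0 ∧ K'.HasRasmussenInvariant s ∧ s ≠ 0

/-- Deleting `K slice` makes the crux a theorem: `K = K' = T(2,3)`, `Y = S³₀(T(2,3))`, `s = 2`.
So sliceness of `K` is load-bearing. [cite: Rasmussen2010, Thm. 4] -/
theorem cruxWithoutSlice_holds : CruxWithoutSlice := by
  obtain ⟨Y, _, _, _, _, _, _, hY⟩ :=
    exists_isIntegralSurgery_holds (torusKnot 2 3 le_rfl (by norm_num) (by norm_num)) 0
  exact ⟨_, _, Y, _, _, ((2 : ℤ) - 1) * ((3 : ℤ) - 1), hY, hY,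
    hasRasmussenInvariant_torusKnot_holds 2 3 le_rfl (by norm_num) (by norm_num), by norm_num⟩

/-- The crux with `s ≠ 0` deleted. -/
def CruxWithoutNonzero : Prop :=
  ∃ (K K' : Knot) (Y : Type) (_ : TopologicalSpace Y) (_ : ChartedSpace (𝔼 3) Y) (s : ℤ),
    IsIntegralSurgery (𝓡 3) Y K 0 ∧ IsIntegralSurgery (𝓡 3) Y K' 0 ∧ K.IsSmoothlySlice ∧
      K'.HasRasmussenInvariant s

/-- Deleting `s ≠ 0` makes the crux a theorem: `K = K' =` unknot, `Y = S³₀(U)`, `s = 0`.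
So `s ≠ 0` is load-bearing. [cite: Rasmussen2010, §3] -/
theorem cruxWithoutNonzero_holds : CruxWithoutNonzero := by
  obtain ⟨Y, _, _, _, _, _, _, hY⟩ := exists_isIntegralSurgery_holds unknot 0
  exact ⟨unknot, unknot, Y, _, _, 0, hY, hY, isSmoothlySlice_unknot, hasRasmussenInvariant_unknot_holds⟩

/-- The crux with the COMMON 0-surgery decoupled (two 3-manifolds `Y`, `Y'`). -/
def CruxWithoutCommonSurgery : Prop :=
  ∃ (K K' : Knot) (Y : Type) (_ : TopologicalSpace Y) (_ : ChartedSpace (𝔼 3) Y)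
    (Y' : Type) (_ : TopologicalSpace Y') (_ : ChartedSpace (𝔼 3) Y') (s : ℤ),
    IsIntegralSurgery (𝓡 3) Y K 0 ∧ IsIntegralSurgery (𝓡 3) Y' K' 0 ∧ K.IsSmoothlySlice ∧
      K'.HasRasmussenInvariant s ∧ s ≠ 0

/-- Decoupling the common 0-surgery makes the crux a theorem: `K =` unknot, `K' = T(2,3)`.
So "the SAME `Y`" is load-bearing. [cite: Rasmussen2010, Thm. 4] -/
theorem cruxWithoutCommonSurgery_holds : CruxWithoutCommonSurgery := by
  obtain ⟨Y, _, _, _, _, _, _, hY⟩ := exists_isIntegralSurgery_holds unknot 0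
  obtain ⟨Y', _, _, _, _, _, _, hY'⟩ :=
    exists_isIntegralSurgery_holds (torusKnot 2 3 le_rfl (by norm_num) (by norm_num)) 0
  exact ⟨unknot, _, Y, _, _, Y', _, _, ((2 : ℤ) - 1) * ((3 : ℤ) - 1), hY, hY',
    isSmoothlySlice_unknot,
    hasRasmussenInvariant_torusKnot_holds 2 3 le_rfl (by norm_num) (by norm_num), by norm_num⟩

/-- The crux with "`Y` is 0-surgery on `K`" deleted. -/
def CruxWithoutSurgeryK : Prop :=
  ∃ (K K' : Knot) (Y : Type) (_ : TopologicalSpace Y) (_ : ChartedSpace (𝔼 3) Y) (s : ℤ),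
    IsIntegralSurgery (𝓡 3) Y K' 0 ∧ K.IsSmoothlySlice ∧ K'.HasRasmussenInvariant s ∧ s ≠ 0

/-- Deleting "`Y = S³₀(K)`" makes the crux a theorem (`K =` unknot, `K' = T(2,3)`, `Y = S³₀(K')`). [cite: Rasmussen2010, Thm. 4] -/
theorem cruxWithoutSurgeryK_holds : CruxWithoutSurgeryK := by
  obtain ⟨Y, _, _, _, _, _, _, hY⟩ :=
    exists_isIntegralSurgery_holds (torusKnot 2 3 le_rfl (by norm_num) (by norm_num)) 0
  exact ⟨unknot, _, Y, _, _, ((2 : ℤ) - 1) * ((3 : ℤ) - 1), hY, isSmoothlySlice_unknot,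
    hasRasmussenInvariant_torusKnot_holds 2 3 le_rfl (by norm_num) (by norm_num), by norm_num⟩

/-- The crux with "`Y` is 0-surgery on `K'`" deleted. -/
def CruxWithoutSurgeryK' : Prop :=
  ∃ (K K' : Knot) (Y : Type) (_ : TopologicalSpace Y) (_ : ChartedSpace (𝔼 3) Y) (s : ℤ),
    IsIntegralSurgery (𝓡 3) Y K 0 ∧ K.IsSmoothlySlice ∧ K'.HasRasmussenInvariant s ∧ s ≠ 0

/-- Deleting "`Y = S³₀(K')`" makes the crux a theorem (`K =` unknot, `Y = S³₀(U)`, `K' = T(2,3)`). [cite: Rasmussen2010, Thm. 4] -/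
theorem cruxWithoutSurgeryK'_holds : CruxWithoutSurgeryK' := by
  obtain ⟨Y, _, _, _, _, _, _, hY⟩ := exists_isIntegralSurgery_holds unknot 0
  exact ⟨unknot, torusKnot 2 3 le_rfl (by norm_num) (by norm_num), Y, _, _,
    ((2 : ℤ) - 1) * ((3 : ℤ) - 1), hY, isSmoothlySlice_unknot,
    hasRasmussenInvariant_torusKnot_holds 2 3 le_rfl (by norm_num) (by norm_num), by norm_num⟩

/-! ## §2 Dead strengthenings (mod Rasmussen's Theorem 1, tree named fact `eq_zero_of_isSmoothlySlice`) -/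

/-- `K = K'` is impossible: a slice knot has `s = 0`. [cite: Rasmussen2010, Thm. 1] -/
theorem crux_false_of_sameKnot (hR : eq_zero_of_isSmoothlySlice) :
    ¬ ∃ (K : Knot) (Y : Type) (_ : TopologicalSpace Y) (_ : ChartedSpace (𝔼 3) Y) (s : ℤ),
      IsIntegralSurgery (𝓡 3) Y K 0 ∧ K.IsSmoothlySlice ∧ K.HasRasmussenInvariant s ∧ s ≠ 0 := by
  rintro ⟨K, Y, _, _, s, -, hsl, hs, hs0⟩
  exact hs0 (hR hs hsl)

/-- A partner `K'` CONCORDANT to `K` is impossible (concordant to slice ⇒ slice, Fox–Milnor; then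
`s(K') = 0`). So witnesses are non-concordant pairs with homeomorphic 0-surgeries.
[cite: Rasmussen2010, Thm. 1] [cite: FoxMilnor1966, §1] -/
theorem crux_false_of_concordant (hR : eq_zero_of_isSmoothlySlice) :
    ¬ ∃ (K K' : Knot) (Y : Type) (_ : TopologicalSpace Y) (_ : ChartedSpace (𝔼 3) Y) (s : ℤ),
      IsIntegralSurgery (𝓡 3) Y K 0 ∧ IsIntegralSurgery (𝓡 3) Y K' 0 ∧ K.IsSmoothlySlice ∧
        K'.HasRasmussenInvariant s ∧ s ≠ 0 ∧ K'.IsConcordant K := by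
  rintro ⟨K, K', Y, _, _, s, -, -, hsl, hs, hs0, hc⟩
  exact hs0 (hR hs (hc.isSmoothlySlice hsl))

/-- A SLICE partner `K'` is impossible. [cite: Rasmussen2010, Thm. 1] -/
theorem crux_false_of_slicePartner (hR : eq_zero_of_isSmoothlySlice) :
    ¬ ∃ (K K' : Knot) (Y : Type) (_ : TopologicalSpace Y) (_ : ChartedSpace (𝔼 3) Y) (s : ℤ),
      IsIntegralSurgery (𝓡 3) Y K 0 ∧ IsIntegralSurgery (𝓡 3) Y K' 0 ∧ K.IsSmoothlySlice ∧
        K'.HasRasmussenInvariant s ∧ s ≠ 0 ∧ K'.IsSmoothlySlice := by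
  rintro ⟨K, K', Y, _, _, s, -, -, -, hs, hs0, hsl'⟩
  exact hs0 (hR hs hsl')

/-! ## §3 Exact strength of a disproof -/

/-- **Manolescu–Piccirillo Lemma 3.3 at crux level** (PROVED in the tree): the partner `K'` of a
witness is slice in a homotopy 4-ball. [cite: ManolescuPiccirillo2023, Lemma 3.3] -/
theorem isHomotopyBallSlice_of_pair {K K' : Knot} {Y : Type} [TopologicalSpace Y]
    [ChartedSpace (𝔼 3) Y] (hK : IsIntegralSurgery (𝓡 3) Y K 0)
    (hK' : IsIntegralSurgery (𝓡 3) Y K' 0) (hsl : K.IsSmoothlySlice) : K'.IsHomotopyBallSlice :=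
  Knot.ManolescuPiccirillo2023_lemma33_sphere_holds K K' Y
    ((FramedLink.isSurgery_single_iff K 0).2 hK) ((FramedLink.isSurgery_single_iff K' 0).2 hK') hsl

/-- The crux implies the registered OPEN conjecture `FGMWRasmussenStrategy` (some knot slice in a
homotopy ball has `s ≠ 0`): it is a strengthening of it. [cite: FreedmanGompfMorrisonWalker2010, §1] -/
theorem fgmwRasmussenStrategy_of_crux (h : Crux) : FGMWRasmussenStrategy := by
  obtain ⟨K, K', Y, _, _, s, hK, hK', hsl, hs, hs0⟩ := h
  exact ⟨K', isHomotopyBallSlice_of_pair hK hK' hsl, s, hs, hs0⟩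

/-- **A positive answer to MMSW Question 9.11 (knots) kills the crux.** This is the weakest
catalogued statement doing so; it is OPEN. [cite: ManolescuMarengonSarkarWillis2023, Question 9.11] -/
theorem not_crux_of_mmsw911 (h : MMSW2023Question911Knot) : ¬ Crux := fun hc =>
  (not_fgmwRasmussenStrategy_iff_question.2 h) (fgmwRasmussenStrategy_of_crux hc)

/-- `SVanishesOnPairs` (0368) from MMSW Q9.11. [cite: ManolescuMarengonSarkarWillis2023, Question 9.11] -/
theorem sVanishesOnPairs_of_mmsw911 (h : MMSW2023Question911Knot) : SVanishesOnPairs :=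
  not_crux_iff_sVanishesOnPairs.1 (not_crux_of_mmsw911 h)

/-- **SPC4 ⇒ every homotopy-ball-slice knot is slice** (contrapositive of the PROVED FGMW lemma).
[cite: FreedmanGompfMorrisonWalker2010, §1] -/
theorem isSmoothlySlice_of_isHomotopyBallSlice_of_spc4 (hS : _root_.SmoothPoincare4) {K : Knot}
    (hK : K.IsHomotopyBallSlice) : K.IsSmoothlySlice := by
  by_contra hns
  obtain ⟨M, i₁, i₂, i₃, i₄, i₅, i₆, ⟨e⟩, hE⟩ :=
    Knot.exists_exotic_of_isHomotopyBallSlice_not_isSmoothlySlice_holds ⟨K, hK, hns⟩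
  obtain ⟨d⟩ := hS M i₄ i₅ e
  exact hE.false d

/-- SPC4 and Rasmussen's Theorem 1 answer MMSW Q9.11 positively. [cite: Rasmussen2010, Thm. 1] -/
theorem mmsw911_of_spc4 (hR : eq_zero_of_isSmoothlySlice) (hS : _root_.SmoothPoincare4) :
    MMSW2023Question911Knot :=
  fun _ hK _ hs => hR hs (isSmoothlySlice_of_isHomotopyBallSlice_of_spc4 hS hK)

/-- **SPC4 + Rasmussen Thm 1 ⇒ ¬ Crux**: a disproof of the crux is no harder than SPC4 (and the
crux is a genuine disproof programme for SPC4). [cite: ManolescuPiccirillo2023, §1 p. 1] -/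
theorem not_crux_of_spc4 (hR : eq_zero_of_isSmoothlySlice) (hS : _root_.SmoothPoincare4) : ¬ Crux :=
  not_crux_of_mmsw911 (mmsw911_of_spc4 hR hS)

/-- SPC4 ⇒ "the 0-surgery type of a knot determines its smooth sliceness" (the body of the route's
kill switch `Assembly2`, item 0367, spelled out — deliberately NOT stated as the decl `Assembly2`, so that
no audit mistakes this SPC4-conditional for a proof of that item), by the two PROVED lemmas (MP 3.3, FGMW);
recorded to fix the strength ordering SPC4 ⇒ Assembly2 ⇒ (mod Rasmussen Thm 1) ¬Crux.
[cite: ManolescuPiccirillo2023, §1 p. 1] -/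
theorem zeroSurgeryDeterminesSliceness_of_spc4 (hS : _root_.SmoothPoincare4)
    (K K' : Knot) (Y : Type) [TopologicalSpace Y] [ChartedSpace (𝔼 3) Y]
    (hK : IsIntegralSurgery (𝓡 3) Y K 0) (hK' : IsIntegralSurgery (𝓡 3) Y K' 0)
    (hsl : K.IsSmoothlySlice) : K'.IsSmoothlySlice :=
  isSmoothlySlice_of_isHomotopyBallSlice_of_spc4 hS (isHomotopyBallSlice_of_pair hK hK' hsl)

/-- `Assembly2` (the kill switch, item 0367) ⇒ ¬ Crux, mod Rasmussen Thm 1. [cite: Rasmussen2010, Thm. 1] -/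
theorem not_crux_of_assembly2 (hR : eq_zero_of_isSmoothlySlice)
    (hA : Theses.ZeroSurgeryExotic.Assembly2) : ¬ Crux := by
  rintro ⟨K, K', Y, _, _, s, hK, hK', hsl, hs, hs0⟩
  exact hs0 (hR hs (hA K K' Y hK hK' hsl))

/-- Layer-2 glue: the crux implies the thesis `ZseThesis` (0364), mod Rasmussen Thm 1.
[cite: Rasmussen2010, Thm. 1] -/
theorem zseThesis_of_crux (hR : eq_zero_of_isSmoothlySlice) (h : Crux) :
    Theses.ZeroSurgeryExotic.ZseThesis := by
  obtain ⟨K, K', Y, _, _, s, hK, hK', hsl, hs, hs0⟩ := h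
  exact ⟨K, K', Y, _, _, hK, hK', hsl, fun hsl' => hs0 (hR hs hsl')⟩

/-- And hence the crux refutes SPC4 (mod Rasmussen Thm 1), through the route's PROVED assembly chain.
[cite: ManolescuPiccirillo2023, §1 p. 1] -/
theorem not_spc4_of_crux (hR : eq_zero_of_isSmoothlySlice) (h : Crux) : ¬ _root_.SmoothPoincare4 :=
  fun hS => not_crux_of_spc4 hR hS h

/-! ## §4 Barrier sub-family: Gluck-twist-born homotopy spheres are useless (MMSW Cor. 1.13) -/

/-- Mod MMSW Cor 1.13 (tree named fact `rasmussen_eq_zero_of_isSliceDiscIn_gluckTwist`): a partner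
`K'` with `s(K') ≠ 0` bounds NO smooth proper disc in the punctured Gluck twist of any 2-knot; so
the Manolescu–Piccirillo sphere `X₀(K') ∪ V` of a witness is never a Gluck twist.
[cite: ManolescuMarengonSarkarWillis2023, Cor. 1.13] -/
theorem crux_witness_avoids_gluckTwist (h113 : rasmussen_eq_zero_of_isSliceDiscIn_gluckTwist)
    {K' : Knot} {s : ℤ} (hs : K'.HasRasmussenInvariant s) (hs0 : s ≠ 0) (K₂ : TwoKnot)
    (X : Type) [TopologicalSpace X] [T2Space X] [SecondCountableTopology X] [ChartedSpace (𝔼 4) X]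
    [IsManifold (𝓡 4) ∞ X] (hX : IsGluckTwist (𝓡 4) X K₂) (e : 𝔼 4 → X) (f : 𝔼 2 → X) :
    ¬ K'.IsSliceDiscIn X e f :=
  fun hK => hs0 (h113 K₂ X hX K' e f hK s hs)

/-! ## §6 Normalisations of the search (parity) -/

/-- Every Rasmussen invariant of a knot is even (tree theorem `even_rasmussenInvariant_holds` at diagram
level, lifted to the knot-level predicate). [cite: Rasmussen2010, Prop. 3.3] -/
theorem hasRasmussenInvariant_even {K : Knot} {s : ℤ} (h : K.HasRasmussenInvariant s) : Even s := by
  obtain ⟨K', D, -, hD, rfl⟩ := h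
  exact GaussDiagram.even_rasmussenInvariant_holds ⟨K', hD⟩

/-- The crux with the witness clause normalised to `2 ≤ |s|` (equivalent, by parity): a search may
discard odd values and `|s| = 1` outright. [cite: Rasmussen2010, Prop. 3.3] -/
theorem crux_iff_two_le_abs : Crux ↔
    ∃ (K K' : Knot) (Y : Type) (_ : TopologicalSpace Y) (_ : ChartedSpace (𝔼 3) Y) (s : ℤ),
      IsIntegralSurgery (𝓡 3) Y K 0 ∧ IsIntegralSurgery (𝓡 3) Y K' 0 ∧ K.IsSmoothlySlice ∧
        K'.HasRasmussenInvariant s ∧ 2 ≤ |s| := by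
  constructor
  · rintro ⟨K, K', Y, _, _, s, hK, hK', hsl, hs, hs0⟩
    refine ⟨K, K', Y, _, _, s, hK, hK', hsl, hs, ?_⟩
    obtain ⟨t, rfl⟩ := hasRasmussenInvariant_even hs
    have ht : t ≠ 0 := by rintro rfl; exact hs0 (by simp)
    rw [← two_mul, abs_mul, abs_two]
    have : 1 ≤ |t| := Int.one_le_abs ht
    linarith
  · rintro ⟨K, K', Y, _, _, s, hK, hK', hsl, hs, hs2⟩
    refine ⟨K, K', Y, _, _, s, hK, hK', hsl, hs, ?_⟩
    rintro rfl
    simp at hs2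

/-! ## §7 The price of a witness: an exotic `ℂℙ²`-sum (MMSW 2023 §9.3) — cycle 2

Printed input (materialised, arXiv:1910.08195 p. 30, §9.3 after Question 9.11): "When `X` was obtained by a
Gluck twist from `S⁴`, the key facts we used to answer this question in the affirmative were that
`X # ℂℙ² ≅ ℂℙ²` and `X # ℂℙ²bar ≅ ℂℙ²bar`. The same result would hold for any homotopy 4-sphere `X`
satisfying `X # (#ʳℂℙ²) = #ʳℂℙ²` and `X # (#ʳℂℙ²bar) = #ʳℂℙ²bar` for some `r`." The proof is that of
Cor. 6.15 (p. 19): `L` strongly H-slice in `X` ⇒ in `X # ℂℙ²bar ≅ ℂℙ²bar` and (mirror) in `ℂℙ²bar`;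
Cor. 6.13 (`L` strongly H-slice in `#ᵗℂℙ²bar` ⇒ `s(L) ≤ 1 - |L|`) for `L` and `L̄`, whence equality by
`s(L) + s(L̄) ≥ 2 - 2|L|`. We vendor the case `r = 1`, `|L| = 1` as a named HYPOTHESIS (not a tree fact;
this work file may not add Literature facts), phrased over the tree's orientation-free `IsConnectedSum`
exactly like the catalogued `gluckTwist_connectedSum_complexProjectivePlane`: "every closed smooth connected
sum of `X` with `ℂℙ²` is diffeomorphic to `ℂℙ²`" is the conjunction of the two oriented dissolutions. -/

section CP2Cost

open ContinuousMap

/-- Local notation: the standard `4`-sphere. -/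
local notation "𝕊⁴" => (Metric.sphere (0 : EuclideanSpace ℝ (Fin 5)) 1)

/-! The predicate `DissolvesInCP2` (every closed smooth connected sum of `X` with `ℂℙ²` is `≅ ℂℙ²`,
orientation-free hence both oriented dissolutions), the named fact `mmsw2023_sZero_of_dissolvesInCP2`
(MMSW 2023 §9.3, `r = 1`, knots) and the theorems `dissolvesInCP2_of_isGluckTwist`,
`sZero_of_isSliceDiscIn_gluckTwist_of_mmsw2023`, `mmsw2023Question911Knot_of_cp2Rigid`,
`not_fgmwRasmussenStrategy_of_cp2Rigid`, `exoticCP2Sum_of_fgmwRasmussenStrategy` are now IN THE CATALOGUE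
(`Literature/Barriers/SmoothPoincare4/GluckTwistsDissolve.lean`, section "Beyond Gluck twists", p76409,
reviewer page-checked against arXiv:1910.08195 p. 30 / p. 19); this section keeps only the crux-level
corollaries and the Summits-side facts (which may use the summit statement `SmoothPoincare4`). -/

/-- **Kill hypothesis: `ℂℙ²` is smoothly rigid among its sums with homotopy 4-spheres** — every closed
smooth homotopy 4-sphere `DissolvesInCP2`, i.e. every closed smooth `Σ # ℂℙ²` (either orientation) with
`Σ ≃ₕ S⁴` is diffeomorphic to `ℂℙ²`. Implied by SPC4 (`cp2Rigid_of_spc4`, proved) and, on paper, by the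
tree's registered open statement `Literature.Topology.FourManifolds.NoExoticComplexProjectivePlaneConjecture`
(uniqueness of the smooth structure on `ℂℙ²`; bridge: Freedman `Σ ≈ S⁴`, Brown's topological Schoenflies
theorem and the Alexander trick give `Σ # ℂℙ² ≈ ℂℙ²` — not in the tree); OPEN — no exotic `ℂℙ²` is
known (Manolescu 2026 survey, Question 3.2). The catalogue carries it only as a spelled-out hypothesis (the
gate refuses new `@[conjecture]` statements in Literature); a planner wanting it as the route's second
kill switch files it Summits-side. [folklore] -/
def CP2RigidOnHomotopySphereSums : Prop :=
  ∀ (X : Type) [TopologicalSpace X] [T2Space X] [SecondCountableTopology X] [ChartedSpace (𝔼 4) X]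
    [IsManifold (𝓡 4) ∞ X] [CompactSpace X], Nonempty (X ≃ₕ 𝕊⁴) → DissolvesInCP2 X

/-- MMSW's lemma + `ℂℙ²`-rigidity answer Question 9.11 (knots) positively (catalogue theorem
`mmsw2023Question911Knot_of_cp2Rigid`). [cite: ManolescuMarengonSarkarWillis2023, §9.3] -/
theorem mmsw911_of_cp2Rigid (hM : mmsw2023_sZero_of_dissolvesInCP2) (hC : CP2RigidOnHomotopySphereSums) :
    MMSW2023Question911Knot :=
  mmsw2023Question911Knot_of_cp2Rigid hM hC

/-- **New kill route: `ℂℙ²`-rigidity on homotopy-sphere sums kills the crux** (mod MMSW's §9.3 fact).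
[cite: ManolescuMarengonSarkarWillis2023, §9.3] -/
theorem not_crux_of_cp2Rigid (hM : mmsw2023_sZero_of_dissolvesInCP2) (hC : CP2RigidOnHomotopySphereSums) :
    ¬ Crux :=
  not_crux_of_mmsw911 (mmsw911_of_cp2Rigid hM hC)

/-- **The price of a crux witness: an exotic `ℂℙ²`-sum** (mod MMSW's §9.3 fact): the Manolescu–Piccirillo
sphere `X` of a witness (PROVED Lemma 3.3) carries the `K'`-disc with `s(K') ≠ 0`, and some closed smooth
connected sum of `X` with `ℂℙ²` is not diffeomorphic to `ℂℙ²`. So the `s`-witness 0-surgery route to an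
exotic `S⁴` necessarily also produces an exotic `ℂℙ²` (up to orientation) — a second open problem
(Manolescu 2026, Question 3.2, case `n = 1`) it must settle on the way.
[cite: ManolescuMarengonSarkarWillis2023, §9.3] [cite: ManolescuPiccirillo2023, Lemma 3.3] -/
theorem exoticCP2Sum_of_crux (hM : mmsw2023_sZero_of_dissolvesInCP2) (h : Crux) :
    ∃ (X : Type) (_ : TopologicalSpace X) (_ : T2Space X) (_ : SecondCountableTopology X)
      (_ : ChartedSpace (𝔼 4) X) (_ : IsManifold (𝓡 4) ∞ X) (_ : CompactSpace X),
      Nonempty (X ≃ₕ 𝕊⁴) ∧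
      (∃ (K : Knot) (e : 𝔼 4 → X) (f : 𝔼 2 → X) (s : ℤ),
        K.IsSliceDiscIn X e f ∧ K.HasRasmussenInvariant s ∧ s ≠ 0) ∧
      ∃ (P : Type) (_ : TopologicalSpace P) (_ : T2Space P) (_ : SecondCountableTopology P)
        (_ : ChartedSpace (𝔼 4) P) (_ : IsManifold (𝓡 4) ∞ P) (_ : CompactSpace P),
        IsConnectedSum (𝓡 4) (𝓡 4) (𝓡 4) X ComplexProjectivePlane P ∧
          IsEmpty (P ≃ₘ⟮𝓡 4, 𝓡 4⟯ ComplexProjectivePlane) :=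
  exoticCP2Sum_of_fgmwRasmussenStrategy hM (fgmwRasmussenStrategy_of_crux h)

/-- **SPC4 ⇒ the kill hypothesis** (PROVED from tree theorems): under SPC4 a closed smooth homotopy
4-sphere `X` is `≅ S⁴`; transport the sum along it (`IsConnectedSum.of_diffeomorph_left`) and use
`ℂℙ² # S⁴ ≅ ℂℙ²` (`nonempty_diffeomorph_of_isConnectedSum_sphere'`, Kervaire–Milnor's "`Sⁿ` serves as
identity"). So `CP2RigidOnHomotopySphereSums` lies between SPC4 and (mod MMSW) `¬ Crux`.
[cite: KervaireMilnor1963, §2] -/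
theorem cp2Rigid_of_spc4 (hS : _root_.SmoothPoincare4) : CP2RigidOnHomotopySphereSums := by
  intro X _ _ _ _ _ _ hX P _ _ _ _ _ _ hP
  obtain ⟨e⟩ := hX
  obtain ⟨d⟩ := hS X ‹_› ‹_› e
  exact nonempty_diffeomorph_of_isConnectedSum_sphere' ((hP.of_diffeomorph_left d).symm)

/-- Hence SPC4 kills the crux mod MMSW's §9.3 fact ALONE (a second derivation of `not_crux_of_spc4`,
trading Rasmussen's Theorem 1 for the dissolution lemma). [cite: ManolescuMarengonSarkarWillis2023, §9.3] -/
theorem not_crux_of_spc4' (hM : mmsw2023_sZero_of_dissolvesInCP2) (hS : _root_.SmoothPoincare4) : ¬ Crux :=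
  not_crux_of_cp2Rigid hM (cp2Rigid_of_spc4 hS)

/-! **One fact runs everything** (catalogue, `GluckTwistsDissolveBeyondGluckProofs.lean`, p77807): the §9.3
fact contains Rasmussen's Theorem 1 (`mmsw2023_sZero_of_dissolvesInCP2.eq_zero_of_isSmoothlySlice`) and MMSW
Cor. 1.13 in full (`mmsw2023_sZero_of_dissolvesInCP2.rasmussen_eq_zero_of_isSliceDiscIn_gluckTwist`), so every
"mod Rasmussen" lemma of §2–§4 and the glue `Crux ⇒ ZseThesis` run mod `mmsw2023_sZero_of_dissolvesInCP2`
alone — compose e.g. `zseThesis_of_crux (mmsw2023_sZero_of_dissolvesInCP2.eq_zero_of_isSmoothlySlice hM)`,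
`crux_witness_avoids_gluckTwist (mmsw2023_sZero_of_dissolvesInCP2.rasmussen_eq_zero_of_isSliceDiscIn_gluckTwist hM)`.
(Cycle 3: the primed one-liners are written — `OneFact.lean` in the seat's folder — and join this file as §10 once the
farm serves the freshly landed module.) -/

end CP2Cost

/-! ## §8 Topological witnesses are dead (mod Freedman) — cycle 2 -/

/-- **Freedman** (named hypothesis, the same Prop as `Ideator1Sketch.isTopologicallySlice_of_isHomotopyBallSlice`):
a knot bounding a smooth disc in a homotopy 4-ball is topologically slice (the homotopy ball is
homeomorphic to `B⁴`, Freedman 1982 Thm. 1.6; the smooth disc is locally flat). Not a tree fact.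
[cite: Freedman1982, Thm. 1.6] -/
def isTopologicallySlice_of_isHomotopyBallSlice : Prop :=
  ∀ K : Knot, K.IsHomotopyBallSlice → K.IsTopologicallySlice

/-- Mod Freedman, the partner `K'` of a 0-surgery pair with `K` smoothly slice is TOPOLOGICALLY slice
(Manolescu–Piccirillo Lemma 3.3, PROVED, then Freedman). [cite: ManolescuPiccirillo2023, Lemma 3.3] -/
theorem isTopologicallySlice_partner (hF : isTopologicallySlice_of_isHomotopyBallSlice) {K K' : Knot}
    {Y : Type} [TopologicalSpace Y] [ChartedSpace (𝔼 3) Y] (hK : IsIntegralSurgery (𝓡 3) Y K 0)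
    (hK' : IsIntegralSurgery (𝓡 3) Y K' 0) (hsl : K.IsSmoothlySlice) : K'.IsTopologicallySlice :=
  hF K' (isHomotopyBallSlice_of_pair hK hK' hsl)

/-- **The topological-witness variant of the crux is FALSE** (mod Freedman): there is no 0-surgery pair
with `K` smoothly slice and `K'` not topologically slice. Hence no topological concordance obstruction
(signature, Levine–Tristram, Arf, Fox–Milnor, Casson–Gordon, …) can ever certify the partner of a witness;
the witness clause must be a smooth-only obstruction, as `s ≠ 0` is. [cite: ManolescuPiccirillo2023, Lemma 3.3] -/
theorem cruxTopWitness_false_of_freedman (hF : isTopologicallySlice_of_isHomotopyBallSlice) :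
    ¬ ∃ (K K' : Knot) (Y : Type) (_ : TopologicalSpace Y) (_ : ChartedSpace (𝔼 3) Y),
        IsIntegralSurgery (𝓡 3) Y K 0 ∧ IsIntegralSurgery (𝓡 3) Y K' 0 ∧ K.IsSmoothlySlice ∧
          ¬ K'.IsTopologicallySlice := by
  rintro ⟨K, K', Y, _, _, hK, hK', hsl, hnt⟩
  exact hnt (isTopologicallySlice_partner hF hK hK' hsl)

/-- Profile of a witness, collected (mod Rasmussen Thm 1 and Freedman): `K'` is slice in a homotopy
ball, topologically slice, NOT smoothly slice, not concordant to `K`. [cite: ManolescuPiccirillo2023, Lemma 3.3] -/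
theorem witness_profile (hR : eq_zero_of_isSmoothlySlice) (hF : isTopologicallySlice_of_isHomotopyBallSlice)
    {K K' : Knot} {Y : Type} [TopologicalSpace Y] [ChartedSpace (𝔼 3) Y] {s : ℤ}
    (hK : IsIntegralSurgery (𝓡 3) Y K 0) (hK' : IsIntegralSurgery (𝓡 3) Y K' 0)
    (hsl : K.IsSmoothlySlice) (hs : K'.HasRasmussenInvariant s) (hs0 : s ≠ 0) :
    K'.IsHomotopyBallSlice ∧ K'.IsTopologicallySlice ∧ ¬ K'.IsSmoothlySlice ∧ ¬ K'.IsConcordant K :=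
  ⟨isHomotopyBallSlice_of_pair hK hK' hsl, isTopologicallySlice_partner hF hK hK' hsl,
    fun hsl' ↦ hs0 (hR hs hsl'), fun hc ↦ hs0 (hR hs (hc.isSmoothlySlice hsl))⟩

/-! ## §9 Homotopy-ball-blind invariants: the technique class that cannot witness; the τ-filter — cycle 3

An abstract knot-invariant predicate `ι : Knot → ℤ → Prop` ("`v` is a value of the invariant on `K`", in the
style of `Knot.HasRasmussenInvariant`) is BLIND on homotopy balls if it vanishes on every knot slice in a
homotopy 4-ball. Printed members of the blind class (none of them formalised in the tree, whence the abstract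
treatment): Ozsváth–Szabó's `τ` — "Let `W` be a smooth, oriented four-manifold with `b₂⁺(W) = 0 = b₁(W)`, and
`∂W = S³` ... then `2τ(K) + |[Σ]| + [Σ]·[Σ] ≤ 2g(Σ)`" [cite: OzsvathSzabo2003FourBallGenus, Thm. 1.1], applied in
a homotopy ball to the disc and to its mirror; FGMW: "if `K` is slice in any homotopy 4-ball, then `τ(K) = 0`"
[cite: FreedmanGompfMorrisonWalker2010, §1 p. 4]; with `τ` every knot-Floer concordance invariant (`ε`, `ν⁺`,
`Υ`, …: they factor through ℤ-homology concordance), the bound from `s♯` [cite: KronheimerMrowka2013, Cor. 1.1],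
every obstruction to the branched double cover bounding an equivariant `ℤ/2`-homology ball (Dai–Kang–Mallick–
Park–Stoffregen 2024, p. 3: the `(2,1)`-cable of `4₁` "is not slice in any `ℤ/2ℤ`-homology ball"), and, by
Freedman (§8), every topological concordance invariant. NOT known to be blind: Rasmussen's `s` — that is
exactly MMSW Question 9.11 (`isHomotopyBallBlind_rasmussen_iff`). -/

section Blind

/-- **Technique class: knot invariants blind on homotopy 4-balls** — `ι K v` vanishes (`v = 0`) whenever `K`
is slice in a homotopy 4-ball (`Knot.IsHomotopyBallSlice`). [cite: FreedmanGompfMorrisonWalker2010, §1 p. 4] -/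
def IsHomotopyBallBlind (ι : Knot → ℤ → Prop) : Prop :=
  ∀ (K : Knot) (v : ℤ), K.IsHomotopyBallSlice → ι K v → v = 0

/-- **MMSW Question 9.11 (knots) is precisely the statement "Rasmussen's `s` is blind"** (definitional).
[cite: ManolescuMarengonSarkarWillis2023, Question 9.11] -/
theorem isHomotopyBallBlind_rasmussen_iff :
    IsHomotopyBallBlind Knot.HasRasmussenInvariant ↔ MMSW2023Question911Knot :=
  ⟨fun h K hK s hs ↦ h K s hK hs, fun h K v hK hv ↦ h K hK v hv⟩

variable {ι : Knot → ℤ → Prop}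

/-- **A blind invariant vanishes on the partner of every 0-surgery pair with `K` slice** (Manolescu–Piccirillo
Lemma 3.3, PROVED: the partner is slice in a homotopy ball). [cite: ManolescuPiccirillo2023, Lemma 3.3] -/
theorem blind_eq_zero_on_partner (hι : IsHomotopyBallBlind ι) {K K' : Knot} {Y : Type} [TopologicalSpace Y]
    [ChartedSpace (𝔼 3) Y] (hK : IsIntegralSurgery (𝓡 3) Y K 0) (hK' : IsIntegralSurgery (𝓡 3) Y K' 0)
    (hsl : K.IsSmoothlySlice) {v : ℤ} (hv : ι K' v) : v = 0 :=
  hι K' v (isHomotopyBallSlice_of_pair hK hK' hsl) hv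

/-- **The crux with its witness clause read through ANY blind invariant is FALSE**: no 0-surgery pair with
`K` slice has a partner with a non-zero blind invariant. So `τ`, `ε`, `ν⁺`, `Υ`, the `s♯`-bound, `d`-invariant
and branched-cover obstructions, signatures and Casson–Gordon invariants can never certify a partner: the
witness must be an invariant NOT known to be blind — `s` and its refinements. [cite: FreedmanGompfMorrisonWalker2010, §1 p. 4] -/
theorem cruxWithBlindWitness_false (hι : IsHomotopyBallBlind ι) :
    ¬ ∃ (K K' : Knot) (Y : Type) (_ : TopologicalSpace Y) (_ : ChartedSpace (𝔼 3) Y) (v : ℤ),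
        IsIntegralSurgery (𝓡 3) Y K 0 ∧ IsIntegralSurgery (𝓡 3) Y K' 0 ∧ K.IsSmoothlySlice ∧
          ι K' v ∧ v ≠ 0 := by
  rintro ⟨K, K', Y, _, _, v, hK, hK', hsl, hv, hv0⟩
  exact hv0 (blind_eq_zero_on_partner hι hK hK' hsl hv)

/-- Hence **the crux is exactly the assertion that `s` is NOT blind on 0-surgery-born homotopy balls**:
blindness of `s` (= MMSW Q9.11) kills it — a third derivation of `not_crux_of_mmsw911`, now as an instance of
the technique-class statement. [cite: ManolescuMarengonSarkarWillis2023, Question 9.11] -/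
theorem not_crux_of_blind (h : IsHomotopyBallBlind Knot.HasRasmussenInvariant) : ¬ Crux :=
  cruxWithBlindWitness_false h

/-- **THE FRIEND LEMMA.** Let `ι` be blind, a concordance invariant (`hconc`) and defined on every knot
(`hex`). If `Y` is `0`-surgery on `K` and on `K'`, and `K'` is concordant to a knot `K₀` with `ι(K₀) = v ≠ 0`,
then `K` is NOT smoothly slice: otherwise `K'` is slice in a homotopy ball (MP 3.3), so `ι(K') = 0`, while
`ι(K') = ι(K₀) = v` by concordance invariance.
INSTANCE IN PRINT (`ι = τ`: blind by Ozsváth–Szabó 2003 Thm. 1.1, a concordance invariant defined for every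
knot): Kegel–Spreer, *The search for exotic knot traces* (arXiv:2603.22438, 2026), §6.2(1) p. 17 — the
262-crossing knot `W₊''` of their Fig. 11 shares its `0`-surgery with `W₊'`, which is concordant to the positive
untwisted Whitehead double `W₊` of the right-handed trefoil; "We do not know if `W₊''` is smoothly slice."
Since `τ(W₊) = 1` (Hedden, Geom. Topol. 11 (2007), Thm. 1.4: `τ(D₊(K,t)) = 1` for `t < 2τ(K)`), this lemma
answers: `W₊''` is NOT slice. As `s(W₊) = 2`, the pair `(W₊'', W₊')` was the one printed live candidate for this
crux with a plain `s ≠ 0` partner; it is dead. Likewise §6.2(3) ibid.: the 114-crossing friend `C''` of a knot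
concordant to the `(2,1)`-cable of `4₁` is not slice (`ι` = the DKMPS `ℤ/2`-homology-ball obstruction).
[cite: OzsvathSzabo2003FourBallGenus, Thm. 1.1] [cite: ManolescuPiccirillo2023, Lemma 3.3] -/
theorem not_slice_of_pair_of_concordant_of_blind (hι : IsHomotopyBallBlind ι)
    (hconc : ∀ {K K' : Knot} {v v' : ℤ}, ι K v → ι K' v' → K.IsConcordant K' → v = v')
    (hex : ∀ K : Knot, ∃ v, ι K v)
    {K K' K₀ : Knot} {Y : Type} [TopologicalSpace Y] [ChartedSpace (𝔼 3) Y]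
    (hK : IsIntegralSurgery (𝓡 3) Y K 0) (hK' : IsIntegralSurgery (𝓡 3) Y K' 0)
    (hc : K'.IsConcordant K₀) {v : ℤ} (hv : ι K₀ v) (hv0 : v ≠ 0) : ¬ K.IsSmoothlySlice := by
  intro hsl
  obtain ⟨w, hw⟩ := hex K'
  exact hv0 ((hconc hw hv hc).symm.trans (blind_eq_zero_on_partner hι hK hK' hsl hw))

/-- **The τ-filter on partners.** In a witness of the crux the partner `K'` is concordant to NO knot carrying
a non-zero value of a blind concordance invariant defined everywhere — with `ι = τ`: `τ(K') = 0` although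
`s(K') ≠ 0`, so `K'` lives in the Hedden–Ording regime `s ≠ 2τ`; positive, quasipositive, alternating,
quasi-alternating, squeezed and L-space knots, and knots concordant to a Whitehead double `D₊(J, t)` with
`t < 2τ(J)`, are never partners. [cite: OzsvathSzabo2003FourBallGenus, Thm. 1.1] -/
theorem partner_not_concordant_of_blind (hι : IsHomotopyBallBlind ι)
    (hconc : ∀ {K K' : Knot} {v v' : ℤ}, ι K v → ι K' v' → K.IsConcordant K' → v = v')
    (hex : ∀ K : Knot, ∃ v, ι K v)
    {K K' K₀ : Knot} {Y : Type} [TopologicalSpace Y] [ChartedSpace (𝔼 3) Y]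
    (hK : IsIntegralSurgery (𝓡 3) Y K 0) (hK' : IsIntegralSurgery (𝓡 3) Y K' 0)
    (hsl : K.IsSmoothlySlice) {v : ℤ} (hv : ι K₀ v) (hv0 : v ≠ 0) : ¬ K'.IsConcordant K₀ :=
  fun hc ↦ not_slice_of_pair_of_concordant_of_blind hι hconc hex hK hK' hc hv hv0 hsl

/-- The friend lemma read for `s` itself: GIVEN that `s` is blind (Q9.11, OPEN) and concordance invariance of
`s` (named fact `HasRasmussenInvariant.eq_of_isConcordant`), a `0`-friend of a knot concordant to a knot with
`s ≠ 0` is not slice — the form of the question attacked by Kegel–Spreer's Algorithm 6 (existence of a Rasmussen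
invariant is the discharged `Knot.exists_hasGaussDiagram_of_isIsotopic_holds`). [cite: Rasmussen2010, Thm. 1] -/
theorem not_slice_of_pair_of_concordant_of_sBlind (h911 : MMSW2023Question911Knot)
    (hC : HasRasmussenInvariant.eq_of_isConcordant)
    {K K' K₀ : Knot} {Y : Type} [TopologicalSpace Y] [ChartedSpace (𝔼 3) Y]
    (hK : IsIntegralSurgery (𝓡 3) Y K 0) (hK' : IsIntegralSurgery (𝓡 3) Y K' 0)
    (hc : K'.IsConcordant K₀) {s : ℤ} (hs : K₀.HasRasmussenInvariant s) (hs0 : s ≠ 0) :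
    ¬ K.IsSmoothlySlice :=
  not_slice_of_pair_of_concordant_of_blind (isHomotopyBallBlind_rasmussen_iff.2 h911)
    (fun h h' hc ↦ hC h h' hc)
    (fun K ↦ by
      obtain ⟨K'', D, hK'', hD⟩ := Knot.exists_hasGaussDiagram_of_isIsotopic_holds K
      exact ⟨D.rasmussenInvariant, K'', D, hK'', hD, rfl⟩)
    hK hK' hc hs hs0

end Blind

/-! ## §11 Sign normalisation of the witness (unconditional) — cycle 3

The four pair hypotheses are closed under simultaneous mirror image with `s ↦ -s` (the sibling disprover's
`ZseSVanishesOnPairs.Negative.pair_mirror`: `IsIntegralSurgery` is orientation-blind — `S³₀(K̄) = -S³₀(K)` is the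
same unoriented `Y` —, sliceness is mirror-invariant, `s(K̄) = -s(K)`; all PROVED). So the `∃`-form of the crux
may fix the sign of the witness, and with parity (§6) read `2 ≤ s(K')`. -/

section Sign

open Theorems.ZseSVanishesOnPairs.Negative in
/-- **The crux is equivalent to its positive form** (`0 < s(K')`): mirror a negative witness. Unconditional. [folklore] -/
theorem crux_iff_pos : Crux ↔
    ∃ (K K' : Knot) (Y : Type) (_ : TopologicalSpace Y) (_ : ChartedSpace (𝔼 3) Y) (s : ℤ),
      IsIntegralSurgery (𝓡 3) Y K 0 ∧ IsIntegralSurgery (𝓡 3) Y K' 0 ∧ K.IsSmoothlySlice ∧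
        K'.HasRasmussenInvariant s ∧ 0 < s := by
  constructor
  · rintro ⟨K, K', Y, _, _, s, hK, hK', hsl, hs, hs0⟩
    rcases lt_or_gt_of_ne hs0 with h | h
    · obtain ⟨m1, m2, m3, m4⟩ := pair_mirror hK hK' hsl hs
      exact ⟨K.mirror, K'.mirror, Y, _, _, -s, m1, m2, m3, m4, by omega⟩
    · exact ⟨K, K', Y, _, _, s, hK, hK', hsl, hs, h⟩
  · rintro ⟨K, K', Y, _, _, s, hK, hK', hsl, hs, hs0⟩
    exact ⟨K, K', Y, _, _, s, hK, hK', hsl, hs, hs0.ne'⟩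

/-- **The crux is equivalent to its form with witness clause `2 ≤ s(K')`** (sign by mirror closure, size by
parity `hasRasmussenInvariant_even`): a search may fix the sign, a disproof may assume `s(K') ≥ 2`.
Unconditional. [cite: Rasmussen2010, Prop. 3.3] -/
theorem crux_iff_two_le : Crux ↔
    ∃ (K K' : Knot) (Y : Type) (_ : TopologicalSpace Y) (_ : ChartedSpace (𝔼 3) Y) (s : ℤ),
      IsIntegralSurgery (𝓡 3) Y K 0 ∧ IsIntegralSurgery (𝓡 3) Y K' 0 ∧ K.IsSmoothlySlice ∧
        K'.HasRasmussenInvariant s ∧ 2 ≤ s := by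
  rw [crux_iff_pos]
  constructor
  · rintro ⟨K, K', Y, _, _, s, hK, hK', hsl, hs, hs0⟩
    refine ⟨K, K', Y, _, _, s, hK, hK', hsl, hs, ?_⟩
    obtain ⟨t, rfl⟩ := hasRasmussenInvariant_even hs
    omega
  · rintro ⟨K, K', Y, _, _, s, hK, hK', hsl, hs, hs2⟩
    exact ⟨K, K', Y, _, _, s, hK, hK', hsl, hs, by omega⟩

open Theorems.ZseSVanishesOnPairs.Negative in
/-- Dually **the crux is equivalent to its negative form** (`s(K') ≤ -2`). Unconditional. [cite: Rasmussen2010, Prop. 3.3] -/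
theorem crux_iff_le_neg_two : Crux ↔
    ∃ (K K' : Knot) (Y : Type) (_ : TopologicalSpace Y) (_ : ChartedSpace (𝔼 3) Y) (s : ℤ),
      IsIntegralSurgery (𝓡 3) Y K 0 ∧ IsIntegralSurgery (𝓡 3) Y K' 0 ∧ K.IsSmoothlySlice ∧
        K'.HasRasmussenInvariant s ∧ s ≤ -2 := by
  rw [crux_iff_two_le]
  constructor
  · rintro ⟨K, K', Y, _, _, s, hK, hK', hsl, hs, hs2⟩
    obtain ⟨m1, m2, m3, m4⟩ := pair_mirror hK hK' hsl hs
    exact ⟨K.mirror, K'.mirror, Y, _, _, -s, m1, m2, m3, m4, by omega⟩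
  · rintro ⟨K, K', Y, _, _, s, hK, hK', hsl, hs, hs2⟩
    obtain ⟨m1, m2, m3, m4⟩ := pair_mirror hK hK' hsl hs
    exact ⟨K.mirror, K'.mirror, Y, _, _, -s, m1, m2, m3, m4, by omega⟩


/-- **Amphichiral partners are dead** (mod single-valuedness of `s`: the named facts `Knot.reidemeister` and
`GaussDiagram.rasmussenInvariant_eq_of_equiv`; existence, mirror and isotopy transport are PROVED): if `K'` is
isotopic to its mirror image then every Rasmussen invariant of `K'` vanishes (`s(K̄') = -s(K')`). So a search
discards amphichiral partners outright — whatever their 0-surgery (cf. Kegel–Spreer 2026 p. 4: chiral knots that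
are 0-friends of their mirrors, e.g. `K13n469`, are a different matter). [cite: Rasmussen2010, §3.5] -/
theorem eq_zero_of_amphichiral (hR : Knot.reidemeister) (hinv : GaussDiagram.rasmussenInvariant_eq_of_equiv)
    {K' : Knot} (hamph : K'.IsIsotopic K'.mirror) {s : ℤ} (hs : K'.HasRasmussenInvariant s) : s = 0 := by
  have hs' : K'.HasRasmussenInvariant (-s) := (HasRasmussenInvariant.mirror_holds hs).of_isIsotopic hamph
  have := (Knot.existsUnique_hasRasmussenInvariant Knot.exists_hasGaussDiagram_of_isIsotopic_holds hR hinv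
    K').unique hs hs'
  omega

/-- Hence **the partner of a witness is chiral** (mod single-valuedness of `s`). [cite: Rasmussen2010, §3.5] -/
theorem crux_partner_chiral (hR : Knot.reidemeister) (hinv : GaussDiagram.rasmussenInvariant_eq_of_equiv)
    {K' : Knot} {s : ℤ} (hs : K'.HasRasmussenInvariant s) (hs0 : s ≠ 0) : ¬ K'.IsIsotopic K'.mirror :=
  fun hamph ↦ hs0 (eq_zero_of_amphichiral hR hinv hamph hs)

end Sign

/-! ## §12 Degenerate seed: no witness has `K` = unknot (mod Property R and Rasmussen's Theorem 1) — cycle 3 -/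

section UnknotSeed

/-- **Property R, friend form** (Gabai 1987, Cor. 8.3 with Remark 8.5: the unknot is the only knot with a
`0`-surgery `≅ S¹ × S²`), stated over the crux's own `ℝ³`-charted `Y`: a knot sharing a `0`-surgery with the
unknot is unknotted. Equivalent on paper to the tree's named fact `isUnknot_of_isIntegralSurgery_zero` (stated
on `S² × S¹` with its product model); the passage needs uniqueness of surgery (`nonempty_diffeomorph_of_isIntegralSurgery_holds`,
proved) and transport of `IsIntegralSurgery` across models on DIFFERENT vector spaces (`ℝ³` vs `ℝ² × ℝ¹`), which
the tree does not have (`IsIntegralSurgery.of_diffeomorph` keeps the vector space) — whence this spelled-out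
hypothesis. [cite: GabaiJDG1987, Cor. 8.3 and Remark 8.5] -/
def PropertyRFriendForm : Prop :=
  ∀ (K' : Knot) (Y : Type) [TopologicalSpace Y] [ChartedSpace (𝔼 3) Y],
    IsIntegralSurgery (𝓡 3) Y unknot 0 → IsIntegralSurgery (𝓡 3) Y K' 0 → K'.IsUnknot

/-- **No witness is seeded by the unknot** (mod Property R in friend form and Rasmussen's Theorem 1): a
`0`-friend `K'` of the unknot is unknotted (Gabai), hence slice (`Knot.IsUnknot.isSmoothlySlice`, with the
discharged `Knot.IsSmoothlySlice.of_isIsotopic_holds`), hence `s(K') = 0`. The smallest seed is dead; by §1 every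
seed must be a NON-TRIVIAL slice knot, by §2 not concordant to the partner. [cite: GabaiJDG1987, Cor. 8.3]
[cite: Rasmussen2010, Thm. 1] -/
theorem crux_false_of_unknotSeed (hPR : PropertyRFriendForm) (hR : eq_zero_of_isSmoothlySlice) :
    ¬ ∃ (K' : Knot) (Y : Type) (_ : TopologicalSpace Y) (_ : ChartedSpace (𝔼 3) Y) (s : ℤ),
        IsIntegralSurgery (𝓡 3) Y unknot 0 ∧ IsIntegralSurgery (𝓡 3) Y K' 0 ∧
          K'.HasRasmussenInvariant s ∧ s ≠ 0 := by
  rintro ⟨K', Y, _, _, s, hU, hK', hs, hs0⟩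
  exact hs0 (hR hs ((hPR K' Y hU hK').isSmoothlySlice Knot.IsSmoothlySlice.of_isIsotopic_holds))

end UnknotSeed


/-! ## §5 Near-miss: the kill switch itself (OPEN) -/

/-- **OPEN — the kill.** `SVanishesOnPairs` (item 0368) would refute the crux outright
(`not_crux_iff_sVanishesOnPairs`). Obstruction: it is the 0-surgery-pair case of MMSW 2023
Question 9.11 (`sVanishesOnPairs_of_mmsw911`), open in print: Kronheimer–Mrowka 2013 Cor 1.1
asserted it and was withdrawn (corrigendum); MMSW Cor 1.13 proves the Gluck-twist case only;
Nakamura 2023 Thm 3.13 / Dunfield–Gong 2025 Thm 5.9 prove it for 0-surgery homeomorphisms from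
(super-)special RBG links; Manolescu 2026 (arXiv:2601.05425 p. 24) records no general mechanism.
Tried here: junk escapes (§1, none), strengthenings (§2), reduction to catalogued statements (§3–4);
cycle 2: reduction to `ℂℙ²`-rigidity on homotopy-sphere sums (§7: `not_crux_of_cp2Rigid` — would need
"every `Σ # ℂℙ²`, `Σ` a 0-surgery-born homotopy sphere, is standard", i.e. no exotic `ℂℙ²` of this
shape: open, MMSW Question 9.12 asks even `r`-fold dissolution for balanced-presentation spheres) and
the topological profile (§8, kills only topological variants); cycle 3: the blind-invariant class (§9 — kills every
blind witness and the printed candidate `W₊''`, not `s`), sign/size normalisation (§11), the unknot seed (§12),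
literature re-sweep 2026-08-16 (citing graphs of MMSW 2023 / MP 2023 since 2025: Nahm arXiv:2602.20138 and
Ren–Willis are about exotic TRACES; Kegel–Spreer arXiv:2603.22438 is a search, no vanishing theorem; nothing on
Q9.11/Q9.12). What a disproof needs and nobody has: a
vanishing theorem for `s` on H-slice discs in homotopy balls that are NOT known to dissolve — e.g. a
proof that every homotopy 4-sphere admitting a handle decomposition WITHOUT 1-handles (the MP spheres
of ribbon `K` have no 3-handles, dually no 1-handles after turning over) dissolves in `ℂℙ²` and `ℂℙ²bar`,
or an extension of Ren–Willis lasagna functoriality giving `s ≤ 0` from an H-slice disc in any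
contractible 2-handlebody-with-1-handles. Left as the standing target.
[cite: ManolescuMarengonSarkarWillis2023, Question 9.11] -/
theorem killSwitch_open : SVanishesOnPairs := by
  sorry

end Summit.SmoothPoincare4.SmoothPoincare4.Cruxes.ZseCruxRasmussen.Disproof

end
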